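import Mathlib.Analysis.SpecialFunctions.Log.Base
import Mathlib.Analysis.SpecialFunctions.Pow.Real
import Mathlib.Analysis.SpecialFunctions.Sqrt
import Mathlib.Analysis.Calculus.Deriv.Add
import Mathlib.Analysis.Calculus.Deriv.Mul
import Mathlib.Analysis.Calculus.Deriv.Pow
import Mathlib.Analysis.Calculus.ContDiff.Deriv
import HarnessLib

/-!
# The cell's declared smooth band window `lp-c2-halfoctave/v1` (R2/R3 amplitude rung, RULING R33 (iv))

Cell `pub-fluidc` (FLUID COMPUTER; host summit `NavierStokesRegularity`, negation side, machine
paradigm), prover seat p1. HONEST FRAMING: low prior, high value-of-information experiment on Tao's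
machine paradigm; NOT a claim that NS blows up. Nothing in this file is about the Navier–Stokes
equations: it TYPES the one smooth-window family the cell declared for its information twins
(ATLAS RULING R33 (iv), STATUS 2026-08-23 "WINDOW DECLARATION"; implemented in p1's `r3fwd.py ≥ 0.1.1`,
keys `*_lpv1`), so that every engine implementing "φ from the formula" has an unambiguous target and
the properties the rung's wording relies on ("plateau ≡ 1 EXACTLY on the declared sharp band, ramps
OUTSIDE it, support one half-octave beyond each edge, the same profile at every level by dilation") are
theorems rather than comments.

The window, for a declared sharp band `[a, b)` of wavenumber moduli (`0 < a ≤ b`) and a modulus `s > 0`: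

  `φ_{a,b}(s) = S(2·log₂(s/a) + 1) · S(2·log₂(b/s) + 1)`,  `S(x) = q(clamp(x,0,1))`,
  `q(t) = t³ (10 − 15 t + 6 t²)` (the quintic `C²` "smootherstep").

## Results (namespace `Summit.NavierStokesRegularity.FluidComputer.HalfOctaveWindow`, all over `ℝ`)

* `quintic`, `smootherstep`, `window` — the three definitions above.
* `one_sub_quintic` (`1 − q(t) = (1 − t)³ (1 + 3t + 6t²)`), `quintic_symm` (`q(1 − t) = 1 − q(t)`),
  `quintic_sub_quintic` (factorisation of `q t − q s`), `quintic_monotoneOn` (monotone on `[0,1]`).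
* `smootherstep_of_nonpos`, `smootherstep_of_one_le`, `smootherstep_nonneg`, `smootherstep_le_one`,
  `smootherstep_symm`, `smootherstep_monotone` — `S = 0` on `(-∞,0]`, `= 1` on `[1,∞)`, values in `[0,1]`,
  `S(1 − x) = 1 − S(x)`, monotone on `ℝ`.
* `contDiff_two_smootherstep` — `S` IS `C²` ON `ℝ` (why the family is called `c2`): `q′(t) = 30 t²(1 − t)²`,
  `q″(t) = 60 t(1 − t)(1 − 2t)` (`hasDerivAt_quintic`, `hasDerivAt_quinticDeriv`) vanish at `t = 0, 1`, so the
  pieces glue to second order (`hasDerivAt_comp_clamp`, `hasDerivAt_smootherstep`, `deriv_deriv_smootherstep`).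
* `window_eq_one` — PLATEAU: `φ_{a,b}(s) = 1` for `a ≤ s ≤ b` (so the closed sharp band is inside the
  plateau; the cell's bands are half-open `[a, b)`).
* `window_eq_zero_of_le`, `window_eq_zero_of_ge` — SUPPORT: `φ_{a,b}(s) = 0` for `0 < s ≤ a/√2` and for
  `b·√2 ≤ s` (half an octave below / above the band edges).
* `window_nonneg`, `window_le_one`; `indicator_le_window`, `window_le_indicator` — the sandwich
  `1_{[a,b]} ≤ φ_{a,b} ≤ 1_{(a/√2, b√2)}` on `s > 0` (a window reading dominates the sharp-band reading of a
  field supported in the band and is dominated by the sharp reading of the widened band, mode by mode).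
* `window_dilate` — LEVEL INDEPENDENCE: `φ_{ca,cb}(cs) = φ_{a,b}(s)` for `c > 0`; in particular the level-`n`
  window of a `λ`-adic ladder is the level-`0` window dilated by `λⁿ` (`window_level`).

Deliberately NOT here: the `L^∞ → L^∞` (Lebesgue-constant) bound of the associated lattice multiplier,
uniform in the level — the analytic reason smooth windows are the currency of the tree's floor theorems
(`FluidComputer.LevelReynoldsFloor`, Littlewood–Paley blocks) while sharp shells are not
(`FluidComputer.BandSupOvershoot`; kinematic-cap table `HOME/atlas/rung-next/p1/r3-u0best/kinematic-cap/`: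
`L_φ ≈ 6.8 / 9.1 / 10.6 / 11.0` for the first four levels vs. `9.4 / 17.7 / 36.4 / 73.2` sharp) — measured, not proved.

0 sorry; axioms ⊆ {propext, Classical.choice, Quot.sound}; no named fact introduced.
-/

noncomputable section

namespace Summit.NavierStokesRegularity.FluidComputer.HalfOctaveWindow

open Real Set

/-! ## The quintic profile -/
/-- The quintic smootherstep polynomial `q(t) = t³ (10 − 15 t + 6 t²) = 6t⁵ − 15t⁴ + 10t³`. -/
def quintic (t : ℝ) : ℝ := t ^ 3 * (10 - 15 * t + 6 * t ^ 2)

/-- Its derivative `q′(t) = 30 t² (1 − t)²`. -/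
def quinticDeriv (t : ℝ) : ℝ := 30 * t ^ 2 * (1 - t) ^ 2

/-- Its second derivative `q″(t) = 60 t (1 − t) (1 − 2t)`. -/
def quinticDeriv2 (t : ℝ) : ℝ := 60 * t * (1 - t) * (1 - 2 * t)

/-- `q(0) = 0`. -/ @[simp] theorem quintic_zero : quintic 0 = 0 := by simp [quintic]

/-- `q(1) = 1`. -/ @[simp] theorem quintic_one : quintic 1 = 1 := by norm_num [quintic]

/-- `1 − q(t) = (1 − t)³ (1 + 3t + 6t²)`. -/
theorem one_sub_quintic (t : ℝ) : 1 - quintic t = (1 - t) ^ 3 * (1 + 3 * t + 6 * t ^ 2) := by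
  unfold quintic; ring

/-- Point symmetry about `(1/2, 1/2)`: `q(1 − t) = 1 − q(t)`. -/
theorem quintic_symm (t : ℝ) : quintic (1 - t) = 1 - quintic t := by
  unfold quintic; ring

/-- `q ≥ 0` on `[0, ∞)` (indeed `10 − 15t + 6t² > 0` everywhere). -/
theorem quintic_nonneg {t : ℝ} (ht : 0 ≤ t) : 0 ≤ quintic t := by
  unfold quintic
  have h : 0 ≤ 10 - 15 * t + 6 * t ^ 2 := by nlinarith [sq_nonneg (t - 5 / 4)]
  positivity

/-- `q ≤ 1` on `(-∞, 1]`. -/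
theorem quintic_le_one {t : ℝ} (ht : t ≤ 1) : quintic t ≤ 1 := by
  have h := one_sub_quintic t
  have h1 : 0 ≤ (1 - t) ^ 3 * (1 + 3 * t + 6 * t ^ 2) := by
    apply mul_nonneg (pow_nonneg (by linarith) 3)
    nlinarith [sq_nonneg (t + 1 / 4)]
  linarith

/-- `q t − q s = (t − s) · P(s,t)` with the symmetric quartic cofactor written out. -/
theorem quintic_sub_quintic (s t : ℝ) :
    quintic t - quintic s = (t - s) * (6 * (t ^ 4 + t ^ 3 * s + t ^ 2 * s ^ 2 + t * s ^ 3 + s ^ 4)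
      - 15 * (t ^ 3 + t ^ 2 * s + t * s ^ 2 + s ^ 3) + 10 * (t ^ 2 + t * s + s ^ 2)) := by
  unfold quintic; ring

/-- `q` is monotone on `[0, 1]` (its derivative is `30 t²(1−t)² ≥ 0`; proved here by real algebra). -/
theorem quintic_monotoneOn : MonotoneOn quintic (Icc 0 1) := by
  intro s hs t ht hst
  have hs0 := hs.1; have ht1 := ht.2
  have key : 0 ≤ quintic t - quintic s := by
    rw [quintic_sub_quintic]
    apply mul_nonneg (by linarith)
    nlinarith [mul_nonneg (mul_nonneg hs0 hs0) (sub_nonneg.2 ht1), mul_nonneg hs0 (sub_nonneg.2 hst),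
      sq_nonneg (t - s), sq_nonneg (t + s - 1), mul_nonneg (sub_nonneg.2 hst) (sub_nonneg.2 ht1),
      sq_nonneg (t * (1 - t)), sq_nonneg (s * (1 - s)), sq_nonneg (t - s), mul_nonneg hs0 hs0,
      mul_nonneg (mul_nonneg hs0 (sub_nonneg.2 hst)) (sub_nonneg.2 ht1)]
  linarith

/-! ## `C²` junction conditions -/
/-- `q′ = quinticDeriv`: `d/dt [t³(10 − 15t + 6t²)] = 30 t² (1 − t)²`. -/
theorem hasDerivAt_quintic (t : ℝ) : HasDerivAt quintic (quinticDeriv t) t := by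
  have h3 : HasDerivAt (fun x : ℝ => x ^ 3) (3 * t ^ 2) t := by simpa using hasDerivAt_pow 3 t
  have h4 : HasDerivAt (fun x : ℝ => x ^ 4) (4 * t ^ 3) t := by simpa using hasDerivAt_pow 4 t
  have h5 : HasDerivAt (fun x : ℝ => x ^ 5) (5 * t ^ 4) t := by simpa using hasDerivAt_pow 5 t
  have h := HasDerivAt.add (HasDerivAt.sub (HasDerivAt.const_mul (6:ℝ) h5)
    (HasDerivAt.const_mul (15:ℝ) h4)) (HasDerivAt.const_mul (10:ℝ) h3)
  have e1 : quintic = ((fun x : ℝ => 6 * x ^ 5) - fun x : ℝ => 15 * x ^ 4) + fun x : ℝ => 10 * x ^ 3 := by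
    funext x; simp only [Pi.add_apply, Pi.sub_apply, quintic]; ring
  have e2 : quinticDeriv t = 6 * (5 * t ^ 4) - 15 * (4 * t ^ 3) + 10 * (3 * t ^ 2) := by
    unfold quinticDeriv; ring
  rw [e1, e2]; exact h

/-- `q″ = quinticDeriv2`: `d/dt [30 t²(1 − t)²] = 60 t (1 − t)(1 − 2t)`. -/
theorem hasDerivAt_quinticDeriv (t : ℝ) : HasDerivAt quinticDeriv (quinticDeriv2 t) t := by
  have h2 : HasDerivAt (fun x : ℝ => x ^ 2) (2 * t) t := by simpa using hasDerivAt_pow 2 t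
  have h3 : HasDerivAt (fun x : ℝ => x ^ 3) (3 * t ^ 2) t := by simpa using hasDerivAt_pow 3 t
  have h4 : HasDerivAt (fun x : ℝ => x ^ 4) (4 * t ^ 3) t := by simpa using hasDerivAt_pow 4 t
  have h := HasDerivAt.add (HasDerivAt.sub (HasDerivAt.const_mul (30:ℝ) h4)
    (HasDerivAt.const_mul (60:ℝ) h3)) (HasDerivAt.const_mul (30:ℝ) h2)
  have e1 : quinticDeriv = ((fun x : ℝ => 30 * x ^ 4) - fun x : ℝ => 60 * x ^ 3) + fun x : ℝ => 30 * x ^ 2 := by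
    funext x; simp only [Pi.add_apply, Pi.sub_apply, quinticDeriv]; ring
  have e2 : quinticDeriv2 t = 30 * (4 * t ^ 3) - 60 * (3 * t ^ 2) + 30 * (2 * t) := by
    unfold quinticDeriv2; ring
  rw [e1, e2]; exact h

/-- Junction condition `q′(0) = 0`. -/ @[simp] theorem quinticDeriv_zero : quinticDeriv 0 = 0 := by simp [quinticDeriv]
/-- Junction condition `q′(1) = 0`. -/ @[simp] theorem quinticDeriv_one : quinticDeriv 1 = 0 := by simp [quinticDeriv]
/-- Junction condition `q″(0) = 0`. -/ @[simp] theorem quinticDeriv2_zero : quinticDeriv2 0 = 0 := by simp [quinticDeriv2]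
/-- Junction condition `q″(1) = 0`. -/ @[simp] theorem quinticDeriv2_one : quinticDeriv2 1 = 0 := by simp [quinticDeriv2]

/-- `q′ ≥ 0` everywhere. -/
theorem quinticDeriv_nonneg (t : ℝ) : 0 ≤ quinticDeriv t := by unfold quinticDeriv; positivity

/-! ## The clamped profile `S` -/
/-- The `C²` smootherstep `S(x) = q(clamp(x, 0, 1))`: `0` for `x ≤ 0`, `q(x)` on `[0,1]`, `1` for `x ≥ 1`. -/
def smootherstep (x : ℝ) : ℝ := quintic (max 0 (min x 1))

/-- The clamp `max 0 (min x 1)` lands in `[0, 1]`. -/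
theorem clamp_mem (x : ℝ) : max 0 (min x 1) ∈ Icc (0 : ℝ) 1 :=
  ⟨le_max_left _ _, max_le zero_le_one (min_le_right _ _)⟩

/-- `S = 0` on `(-∞, 0]`. -/
theorem smootherstep_of_nonpos {x : ℝ} (hx : x ≤ 0) : smootherstep x = 0 := by
  unfold smootherstep
  rw [max_eq_left ((min_le_left x 1).trans hx)]
  exact quintic_zero

/-- `S = 1` on `[1, ∞)`. -/
theorem smootherstep_of_one_le {x : ℝ} (hx : 1 ≤ x) : smootherstep x = 1 := by
  unfold smootherstep
  rw [min_eq_right hx, max_eq_right zero_le_one]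
  exact quintic_one

/-- `S = q` on `[0, 1]`. -/
theorem smootherstep_of_mem {x : ℝ} (hx : x ∈ Icc (0 : ℝ) 1) : smootherstep x = quintic x := by
  unfold smootherstep
  rw [min_eq_left hx.2, max_eq_right hx.1]

/-- `0 ≤ S`. -/
theorem smootherstep_nonneg (x : ℝ) : 0 ≤ smootherstep x :=
  quintic_nonneg (clamp_mem x).1

/-- `S ≤ 1`. -/
theorem smootherstep_le_one (x : ℝ) : smootherstep x ≤ 1 :=
  quintic_le_one (clamp_mem x).2

/-- `S(1 − x) = 1 − S(x)`. -/
theorem smootherstep_symm (x : ℝ) : smootherstep (1 - x) = 1 - smootherstep x := by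
  unfold smootherstep
  have : max 0 (min (1 - x) 1) = 1 - max 0 (min x 1) := by
    rcases le_total x 0 with h | h
    · rw [min_eq_right (by linarith : (1:ℝ) ≤ 1 - x), max_eq_right zero_le_one,
        max_eq_left ((min_le_left x 1).trans h)]; ring
    rcases le_total x 1 with h1 | h1
    · rw [min_eq_left (by linarith : 1 - x ≤ 1), max_eq_right (by linarith : (0:ℝ) ≤ 1 - x),
        min_eq_left h1, max_eq_right h]
    · rw [min_eq_left (by linarith : 1 - x ≤ 1), max_eq_left (by linarith : 1 - x ≤ 0),
        min_eq_right h1, max_eq_right zero_le_one]; ring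
  rw [this, quintic_symm]

/-- `S` is monotone on `ℝ`. -/
theorem smootherstep_monotone : Monotone smootherstep := by
  intro x y hxy
  unfold smootherstep
  exact quintic_monotoneOn (clamp_mem x) (clamp_mem y)
    (max_le_max le_rfl (min_le_min hxy le_rfl))


/-! ## `S` is `C²` (the glued profile is twice continuously differentiable) -/
/-- Gluing lemma: if `p` has derivative `p′` everywhere with `p′(0) = p′(1) = 0`, then `x ↦ p(clamp x)` has
derivative `p′(clamp x)` at every real `x` (the constant pieces outside `[0,1]` match to first order). -/
theorem hasDerivAt_comp_clamp {p p' : ℝ → ℝ} (hp : ∀ t, HasDerivAt p (p' t) t) (h0 : p' 0 = 0)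
    (h1 : p' 1 = 0) (x : ℝ) :
    HasDerivAt (fun y => p (max 0 (min y 1))) (p' (max 0 (min x 1))) x := by
  -- the function agrees with `p 0` on `Iic 0`, with `p` on `Icc 0 1`, with `p 1` on `Ici 1`
  have eq_left : ∀ y ∈ Iic (0:ℝ), p (max 0 (min y 1)) = p 0 := fun y hy => by
    rw [max_eq_left ((min_le_left y 1).trans hy)]
  have eq_mid : ∀ y ∈ Icc (0:ℝ) 1, p (max 0 (min y 1)) = p y := fun y hy => by
    rw [min_eq_left hy.2, max_eq_right hy.1]
  have eq_right : ∀ y ∈ Ici (1:ℝ), p (max 0 (min y 1)) = p 1 := fun y hy => by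
    rw [min_eq_right (mem_Ici.1 hy), max_eq_right zero_le_one]
  -- one-sided derivatives at the two junctions
  have left0 : HasDerivWithinAt (fun y => p (max 0 (min y 1))) 0 (Iic 0) 0 :=
    (hasDerivWithinAt_const (0:ℝ) (Iic 0) (p 0)).congr eq_left (eq_left 0 self_mem_Iic)
  have mid : ∀ x ∈ Icc (0:ℝ) 1, HasDerivWithinAt (fun y => p (max 0 (min y 1))) (p' x) (Icc 0 1) x :=
    fun x hx => (hp x).hasDerivWithinAt.congr eq_mid (eq_mid x hx)
  have right1 : HasDerivWithinAt (fun y => p (max 0 (min y 1))) 0 (Ici 1) 1 :=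
    (hasDerivWithinAt_const (1:ℝ) (Ici 1) (p 1)).congr eq_right (eq_right 1 self_mem_Ici)
  rcases lt_trichotomy x 0 with hx | rfl | hx
  · -- x < 0: locally constant
    have hev : (fun y => p (max 0 (min y 1))) =ᶠ[nhds x] fun _ => p 0 :=
      Filter.mem_of_superset (Iio_mem_nhds hx) fun y hy => eq_left y (mem_Iic.2 (le_of_lt hy))
    rw [max_eq_left ((min_le_left x 1).trans hx.le), h0]
    exact (hasDerivAt_const x (p 0)).congr_of_eventuallyEq hev
  · -- x = 0: glue `Iic 0` and `Icc 0 1`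
    have hm := mid 0 ⟨le_rfl, zero_le_one⟩
    rw [h0] at hm
    have hu := left0.union hm
    have hn : Iic (0:ℝ) ∪ Icc 0 1 ∈ nhds (0:ℝ) :=
      Filter.mem_of_superset (Iio_mem_nhds zero_lt_one) fun y hy => by
        rcases le_total y 0 with h | h
        · exact Or.inl h
        · exact Or.inr ⟨h, le_of_lt hy⟩
    simpa [h0] using hu.hasDerivAt hn
  rcases lt_trichotomy x 1 with hx1 | rfl | hx1
  · -- 0 < x < 1: locally `p`
    have hev : (fun y => p (max 0 (min y 1))) =ᶠ[nhds x] p :=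
      Filter.mem_of_superset (Ioo_mem_nhds hx hx1) fun y hy => eq_mid y ⟨hy.1.le, hy.2.le⟩
    rw [min_eq_left hx1.le, max_eq_right hx.le]
    exact (hp x).congr_of_eventuallyEq hev
  · -- x = 1: glue `Icc 0 1` and `Ici 1`
    have hm := mid 1 ⟨zero_le_one, le_rfl⟩
    rw [h1] at hm
    have hu := hm.union right1
    have hn : Icc (0:ℝ) 1 ∪ Ici 1 ∈ nhds (1:ℝ) :=
      Filter.mem_of_superset (Ioi_mem_nhds zero_lt_one) fun y hy => by
        rcases le_total y 1 with h | h
        · exact Or.inl ⟨le_of_lt hy, h⟩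
        · exact Or.inr h
    simpa [h1] using hu.hasDerivAt hn
  · -- 1 < x: locally constant
    have hev : (fun y => p (max 0 (min y 1))) =ᶠ[nhds x] fun _ => p 1 :=
      Filter.mem_of_superset (Ioi_mem_nhds hx1) fun y hy => eq_right y (mem_Ici.2 (le_of_lt hy))
    rw [min_eq_right hx1.le, max_eq_right zero_le_one, h1]
    exact (hasDerivAt_const x (p 1)).congr_of_eventuallyEq hev

/-- `S′(x) = q′(clamp x)` at every real `x`. -/
theorem hasDerivAt_smootherstep (x : ℝ) :
    HasDerivAt smootherstep (quinticDeriv (max 0 (min x 1))) x :=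
  hasDerivAt_comp_clamp hasDerivAt_quintic quinticDeriv_zero quinticDeriv_one x

/-- `deriv S = q′ ∘ clamp`. -/
theorem deriv_smootherstep : deriv smootherstep = fun x => quinticDeriv (max 0 (min x 1)) :=
  funext fun x => (hasDerivAt_smootherstep x).deriv

/-- `S″(x) = q″(clamp x)` at every real `x`. -/
theorem hasDerivAt_deriv_smootherstep (x : ℝ) :
    HasDerivAt (deriv smootherstep) (quinticDeriv2 (max 0 (min x 1))) x := by
  rw [deriv_smootherstep]
  exact hasDerivAt_comp_clamp hasDerivAt_quinticDeriv quinticDeriv2_zero quinticDeriv2_one x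

/-- `deriv (deriv S) = q″ ∘ clamp`. -/
theorem deriv_deriv_smootherstep :
    deriv (deriv smootherstep) = fun x => quinticDeriv2 (max 0 (min x 1)) :=
  funext fun x => (hasDerivAt_deriv_smootherstep x).deriv

/-- `q″ ∘ clamp` is continuous. -/
theorem continuous_quinticDeriv2_clamp : Continuous fun x : ℝ => quinticDeriv2 (max 0 (min x 1)) := by
  have hc : Continuous fun x : ℝ => max 0 (min x 1) := by fun_prop
  have hq : Continuous quinticDeriv2 := by unfold quinticDeriv2; fun_prop
  exact hq.comp hc

/-- The profile `S` is `C²` on `ℝ` — the property the family name `lp-c2-halfoctave/v1` asserts. -/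
theorem contDiff_two_smootherstep : ContDiff ℝ 2 smootherstep := by
  rw [show (2 : WithTop ℕ∞) = 1 + 1 from rfl, contDiff_succ_iff_deriv]
  refine ⟨fun x => (hasDerivAt_smootherstep x).differentiableAt, by simp, ?_⟩
  rw [contDiff_one_iff_deriv]
  exact ⟨fun x => (hasDerivAt_deriv_smootherstep x).differentiableAt,
    deriv_deriv_smootherstep ▸ continuous_quinticDeriv2_clamp⟩

/-! ## The window -/
/-- The declared window `φ_{a,b}(s) = S(2 log₂(s/a) + 1) · S(2 log₂(b/s) + 1)` of the sharp band `[a, b)`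
(family `lp-c2-halfoctave/v1`), as a function of the wavenumber modulus `s`. -/
def window (a b s : ℝ) : ℝ :=
  smootherstep (2 * logb 2 (s / a) + 1) * smootherstep (2 * logb 2 (b / s) + 1)

variable {a b c s : ℝ}

/-- `0 ≤ φ`. -/
theorem window_nonneg (a b s : ℝ) : 0 ≤ window a b s :=
  mul_nonneg (smootherstep_nonneg _) (smootherstep_nonneg _)

/-- `φ ≤ 1`. -/
theorem window_le_one (a b s : ℝ) : window a b s ≤ 1 := by
  unfold window
  calc smootherstep (2 * logb 2 (s / a) + 1) * smootherstep (2 * logb 2 (b / s) + 1)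
      ≤ 1 * 1 := mul_le_mul (smootherstep_le_one _) (smootherstep_le_one _) (smootherstep_nonneg _) zero_le_one
    _ = 1 := one_mul 1

/-- PLATEAU: the window is exactly `1` on the closed sharp band. -/
theorem window_eq_one (ha : 0 < a) (has : a ≤ s) (hsb : s ≤ b) : window a b s = 1 := by
  have hs : 0 < s := ha.trans_le has
  have h1 : 0 ≤ logb 2 (s / a) := logb_nonneg one_lt_two ((one_le_div ha).2 has)
  have h2 : 0 ≤ logb 2 (b / s) := logb_nonneg one_lt_two ((one_le_div hs).2 hsb)
  unfold window
  rw [smootherstep_of_one_le (by linarith), smootherstep_of_one_le (by linarith), one_mul]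

/-- `log₂ 2^{-1/2} = -1/2`. -/
private theorem logb_two_rpow_neg_half : logb 2 ((2:ℝ) ^ (-(1/2:ℝ))) = -(1/2) :=
  logb_rpow two_pos (by norm_num)

/-- `√2 = 2^{1/2}`. -/
private theorem sqrt_two_eq_rpow : Real.sqrt 2 = (2:ℝ) ^ (1/2:ℝ) := Real.sqrt_eq_rpow 2

/-- `1/√2 = 2^{-1/2}`. -/
private theorem inv_sqrt_two_eq_rpow : (Real.sqrt 2)⁻¹ = (2:ℝ) ^ (-(1/2:ℝ)) := by
  rw [sqrt_two_eq_rpow, Real.rpow_neg (by norm_num : (0:ℝ) ≤ 2)]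

/-- SUPPORT, lower side: `φ_{a,b}(s) = 0` for `0 < s ≤ a/√2` (half an octave below the band). -/
theorem window_eq_zero_of_le (ha : 0 < a) (hs : 0 < s) (hsa : s ≤ a / Real.sqrt 2) :
    window a b s = 0 := by
  have hq : s / a ≤ (2:ℝ) ^ (-(1/2:ℝ)) := by
    rw [← inv_sqrt_two_eq_rpow, div_le_iff₀ ha]
    simpa [div_eq_mul_inv, mul_comm] using hsa
  have hl : logb 2 (s / a) ≤ -(1/2) := by
    rw [← logb_two_rpow_neg_half]
    exact logb_le_logb_of_le one_lt_two (div_pos hs ha) hq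
  unfold window
  rw [smootherstep_of_nonpos (by linarith), zero_mul]

/-- SUPPORT, upper side: `φ_{a,b}(s) = 0` for `b √2 ≤ s` (half an octave above the band), `0 < b`. -/
theorem window_eq_zero_of_ge (hb : 0 < b) (hbs : b * Real.sqrt 2 ≤ s) : window a b s = 0 := by
  have hs : 0 < s := lt_of_lt_of_le (mul_pos hb (Real.sqrt_pos.2 two_pos)) hbs
  have hq : b / s ≤ (2:ℝ) ^ (-(1/2:ℝ)) := by
    rw [← inv_sqrt_two_eq_rpow, div_le_iff₀ hs]
    have h2 : 0 < Real.sqrt 2 := Real.sqrt_pos.2 two_pos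
    calc b = b * Real.sqrt 2 * (Real.sqrt 2)⁻¹ := by field_simp
      _ ≤ s * (Real.sqrt 2)⁻¹ := by gcongr
      _ = (Real.sqrt 2)⁻¹ * s := mul_comm _ _
  have hl : logb 2 (b / s) ≤ -(1/2) := by
    rw [← logb_two_rpow_neg_half]
    exact logb_le_logb_of_le one_lt_two (div_pos hb hs) hq
  unfold window
  rw [smootherstep_of_nonpos (x := 2 * logb 2 (b / s) + 1) (by linarith), mul_zero]

/-- Sandwich, lower half: the indicator of the closed band is below the window (on `s > 0`). -/
theorem indicator_le_window (ha : 0 < a) (s : ℝ) :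
    (Icc a b).indicator (fun _ => (1:ℝ)) s ≤ window a b s := by
  by_cases h : s ∈ Icc a b
  · rw [indicator_of_mem h, window_eq_one ha h.1 h.2]
  · rw [indicator_of_notMem h]; exact window_nonneg a b s

/-- Sandwich, upper half: the window is below the indicator of the widened band `(a/√2, b√2)` on `s > 0`. -/
theorem window_le_indicator (ha : 0 < a) (hb : 0 < b) (hs : 0 < s) :
    window a b s ≤ (Ioo (a / Real.sqrt 2) (b * Real.sqrt 2)).indicator (fun _ => (1:ℝ)) s := by
  by_cases h : s ∈ Ioo (a / Real.sqrt 2) (b * Real.sqrt 2)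
  · rw [indicator_of_mem h]; exact window_le_one a b s
  · rw [indicator_of_notMem h]
    simp only [mem_Ioo, not_and_or, not_lt] at h
    rcases h with h | h
    · exact (window_eq_zero_of_le ha hs h).le
    · exact (window_eq_zero_of_ge hb h).le

/-- LEVEL INDEPENDENCE: the family is dilation-covariant, `φ_{ca,cb}(cs) = φ_{a,b}(s)` (`c ≠ 0`). -/
theorem window_dilate (hc : c ≠ 0) (a b s : ℝ) : window (c * a) (c * b) (c * s) = window a b s := by
  unfold window
  rw [mul_div_mul_left s a hc, mul_div_mul_left b s hc]

/-- The level-`n` window of a `λ`-adic band ladder `[a λⁿ, b λⁿ)` is the level-`0` window read at `s/λⁿ`. -/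
theorem window_level {lam : ℝ} (hlam : 0 < lam) (n : ℕ) (a b s : ℝ) :
    window (a * lam ^ n) (b * lam ^ n) s = window a b (s / lam ^ n) := by
  have hc : lam ^ n ≠ 0 := pow_ne_zero n hlam.ne'
  have := window_dilate hc a b (s / lam ^ n)
  rw [mul_div_cancel₀ s hc] at this
  simpa [mul_comm] using this

end Summit.NavierStokesRegularity.FluidComputer.HalfOctaveWindow

end
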